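import Summits.Ventures.YMGap.RobustBall.CentreProjectionWindow
import Summits.Ventures.YMGap.RobustBall.ZNFluxLinkPeeling
import HarnessLib

/-!
# RobustBall/CentreProjectionLink — centre projection for perturbations whose twist defect is a finite-range flux interaction
# with LINK ROWS: `|⟨W_{R×T}⟩_{β,W,L}| ≤ (4 c^{⌈T/s⌉})^{#{r<R : m∣r}}`, `c = 2(d−1)N|β| + b`, `b` = ½ the defect LINK rows

HONEST FRAMING: venture file of the cell `pub-ymgap` (QuantumFields programme), track Y2 ROBUST-BALL, seat ds-4 g9.
WHAT THIS IS: an INEQUALITY BETWEEN LATTICE EXPECTATIONS on a finite torus — `CentreProjectionWindow` (gen 8) with the defect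
rows measured through LINKS.  Twist defects `W(ζ_k U) = c(U) + ∑_t g_t((curl k)|_{supp t}, U)` as there (finitely many flux-local
terms, plaquette supports inside a vertical window `m`), now carrying link-read data: `g_t ∘ curl` reads `k` through a link set `E t`
(`j`-extent of its `i`-links `≤ s`) and moves by at most `δ t e` when `k` changes at the single link `e`; defect LINK rows
`½ ∑_{t : (y,i) ∈ E t} ∑_{y' ≠ y, (y',i) ∈ E t} δ t (y',i) ≤ b`.  NOTHING asked of the twist-invariant part `c(U)`.  Then
(`abs_wilsonLoop_le_of_linkDefect`) `|⟨(1/N) Re tr U_{R×T}⟩_{β,W,L}| ≤ (4 c^{⌈T/s⌉})^{#{r<R : m∣r}}` at `c = 2(d−1)N|β| + b ≤ 1`.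
Mechanism: the `M`-abstract centre projection `abs_expectation_wilsonLoop_le_of_fluxDefect` (gen 8) and the link-row peeling
`ZNFluxW.norm_cavg_ψ_loopSum_le_link`; the Wilson plaquette weights enter with link set = the four links of the plaquette and
variation `2|β|N`, which reproduces the gen-7/8 plaquette row `2(d−1)N|β|` exactly.  Nothing about the continuum, a spectral gap or
Clay; no confinement claim for `SU(N)` beyond the inequality.

References for the blind mechanism AS PRINTED: J. Fröhlich, Phys. Lett. B 83 (1979) 195, Eq. (7)–(9); G. Mack, V. B. Petkova,
Ann. Phys. 123 (1979) 442, §2; the windowed peeling is Durhuus–Fröhlich 1980's.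
-/

noncomputable section

open MeasureTheory Finset
open Literature.MathematicalPhysics.QuantumLattice (fundamentalRep)
open Literature.MathematicalPhysics.QuantumFieldTheory

namespace Summit.Ventures.YMGap.RobustBall

open ZN ZNFluxW

variable {d L N : ℕ} [NeZero L] [NeZero N] {ι : Type*} [Fintype ι]

/-! ### The Wilson plaquette weights: activity bound and link row -/

omit [NeZero L] in
/-- The Wilson plaquette activity is bounded by `|β| N`. [folklore] -/
theorem abs_plaqActivity_le (β : ℝ) (φ : Plaquette d L → ZMod N) (U : GaugeConfig d L (SUN N)) (p : Plaquette d L) :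
    |β * (ψ N (φ p) * ((plaquetteHolonomy U p.1 p.2.1.1 p.2.1.2 : SUN N) : Matrix (Fin N) (Fin N) ℂ).trace).re| ≤ |β| * N := by
  rw [abs_mul]
  refine mul_le_mul_of_nonneg_left ((Complex.abs_re_le_norm _).trans ?_) (abs_nonneg β)
  rw [norm_mul, norm_ψ, one_mul]; exact norm_trace_le _

omit [NeZero N] in
/-- **Half the link row of the Wilson plaquette weights is `≤ 2(d−1)|β|N`** (each `i`-link lies on `≤ 2(d−1)` plaquettes, each
reading exactly one other `i`-link). [folklore] -/
theorem linkRow_plaquette_le (β : ℝ) (i : Fin d) (y : Site d L) :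
    linkRow (fun p : Plaquette d L => linksOf ({p} : Finset (Plaquette d L))) (fun _ _ => 2 * (|β| * N)) i y / 2 ≤
      2 * ((d - 1 : ℕ) : ℝ) * |β| * N := by
  classical
  rw [linkRow_linksOf_eq (fun p : Plaquette d L => ({p} : Finset (Plaquette d L))) (fun _ => |β| * N) i y]
  simp only [iLinks_singleton]
  rw [Finset.sum_filter]
  calc ∑ p : Plaquette d L, (if y ∈ iSites i p then |β| * N * (((iSites i p).card : ℝ) - 1) else 0)
      ≤ ∑ p : Plaquette d L, (if y ∈ iSites i p then |β| * N else 0) := by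
        refine Finset.sum_le_sum fun p _ => ?_
        split_ifs with hp
        · have h2 : ((iSites i p).card : ℝ) ≤ 2 := by exact_mod_cast card_iSites_le i p
          have h0 : 0 ≤ |β| * (N : ℝ) := mul_nonneg (abs_nonneg β) (Nat.cast_nonneg N)
          nlinarith
        · exact le_rfl
    _ = |β| * N * (((Finset.univ : Finset (Plaquette d L)).filter fun p => y ∈ iSites i p).card : ℝ) := by
        rw [← Finset.sum_filter, Finset.sum_const, nsmul_eq_mul, mul_comm]
    _ ≤ |β| * N * (2 * (d - 1) : ℕ) := by
        refine mul_le_mul_of_nonneg_left ?_ (mul_nonneg (abs_nonneg β) (Nat.cast_nonneg N))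
        exact_mod_cast card_filter_mem_iSites_le i y
    _ = 2 * ((d - 1 : ℕ) : ℝ) * |β| * N := by push_cast; ring

/-! ### The induced `ℤ_N` loop under link rows -/

/-- **The induced `ℤ_N` Wilson loop with a finite-range flux defect obeys the windowed area-law bound under LINK ROWS**
`‖znLoopW‖ ≤ (4 c^{⌈T/s⌉})^{#{r<R : m∣r}}` at `c = 2(d−1)N|β| + b ≤ 1` (`N ≥ 2`, `0 < m`, `0 < s`, `2R, 2T ≤ L`), where `b` bounds half
the defect link rows. [folklore] -/
theorem norm_znLoopW_le_link (hN : 2 ≤ N) (β : ℝ) {supp : ι → Finset (Plaquette d L)}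
    {gD : ι → (Plaquette d L → ZMod N) → GaugeConfig d L (SUN N) → ℝ} {E : ι → Finset (Edge d L)} {δ : ι → Edge d L → ℝ}
    (hdep : ∀ t U, DependsOn (fun φ => gD t φ U) (↑(supp t) : Set (Plaquette d L)))
    (hE : ∀ t (k k' : Edge d L → ZMod N) (U : GaugeConfig d L (SUN N)), (∀ e ∈ E t, k e = k' e) →
      gD t (flux k) U = gD t (flux k') U)
    (hδ0 : ∀ t e, 0 ≤ δ t e)
    (hδ : ∀ t (e : Edge d L) (k k' : Edge d L → ZMod N) (U : GaugeConfig d L (SUN N)), (∀ e', e' ≠ e → k e' = k' e') →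
      |gD t (flux k) U - gD t (flux k') U| ≤ δ t e)
    {m : ℕ} (hm : 0 < m)
    (hwin : ∀ t (i : Fin d), ∀ y ∈ iLinks i (supp t), ∀ y' ∈ iLinks i (supp t), (y i - y' i).valMinAbs.natAbs < m)
    {s : ℕ} (hs : 0 < s) (hext : ∀ t (i j : Fin d) (y y' : Site d L), (y, i) ∈ E t → (y', i) ∈ E t → jDist j y' y ≤ s)
    {b : ℝ} (hrowD : ∀ (i : Fin d) (y : Site d L), linkRow E δ i y / 2 ≤ b)
    {c : ℝ} (hc : 2 * ((d - 1 : ℕ) : ℝ) * |β| * N + b ≤ c) (hc1 : c ≤ 1) (U : GaugeConfig d L (SUN N)) (x : Site d L)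
    {i j : Fin d} (hij : i ≠ j) {R T : ℕ} (hR : 2 * R ≤ L) (hT : 2 * T ≤ L) :
    ‖znLoopW β gD U x i j R T‖ ≤ (4 * c ^ ((T + s - 1) / s)) ^ (selIdx m R).card := by
  classical
  refine norm_cavg_ψ_loopSum_le_link hN (supp := suppS supp) (g := gS β gD U)
    (E := Sum.elim (fun p => linksOf ({p} : Finset (Plaquette d L))) E) (δ := Sum.elim (fun _ _ => 2 * (|β| * N)) δ)
    ?_ ?_ ?_ ?_ hij (m := m) ?_ ?_ hc1 hs ?_ x hR hT
  · rintro (p | t)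
    · intro φ φ' h
      simp only [gS, Sum.elim_inl]
      rw [h p (by simp [suppS])]
    · intro φ φ' h
      have e : gD t φ U = gD t φ' U := hdep t U h
      simp only [gS, Sum.elim_inr, e]
  · rintro (p | t) k k' h
    · simp only [gS, Sum.elim_inl]
      rw [flux_congr_of_linksOf (Y := ({p} : Finset (Plaquette d L))) h (Finset.mem_singleton_self p)]
    · simp only [gS, Sum.elim_inr, hE t k k' U h]
  · rintro (p | t) e
    · exact mul_nonneg (by norm_num) (mul_nonneg (abs_nonneg β) (Nat.cast_nonneg N))
    · exact hδ0 t e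
  · rintro (p | t) e k k' h
    · simp only [gS, Sum.elim_inl]
      have h1 := abs_plaqActivity_le β (flux k) U p
      have h2 := abs_plaqActivity_le β (flux k') U p
      calc _ ≤ |β * (ψ N (flux k p) * ((plaquetteHolonomy U p.1 p.2.1.1 p.2.1.2 : SUN N) :
              Matrix (Fin N) (Fin N) ℂ).trace).re| +
            |β * (ψ N (flux k' p) * ((plaquetteHolonomy U p.1 p.2.1.1 p.2.1.2 : SUN N) :
              Matrix (Fin N) (Fin N) ℂ).trace).re| := abs_sub _ _
        _ ≤ |β| * N + |β| * N := add_le_add h1 h2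
        _ = 2 * (|β| * N) := by ring
    · simp only [gS, Sum.elim_inr, neg_sub_neg, abs_sub_comm]
      exact hδ t e k k' U h
  · rintro (p | t) y hy y' hy'
    · simp only [suppS, Sum.elim_inl, iLinks_singleton] at hy hy'
      rw [iDist_eq_zero_of_mem_iSites i p hy hy']; exact hm
    · exact hwin t i y hy y' hy'
  · intro y
    rw [linkRow_sum_elim, add_div]
    exact (add_le_add (linkRow_plaquette_le β i y) (hrowD i y)).trans hc
  · rintro (p | t) y y' hy hy'
    · simp only [Sum.elim_inl, mk_mem_linksOf, iLinks_singleton] at hy hy'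
      exact (jDist_le_one_of_mem_iSites i j p hy hy').trans hs
    · exact hext t i j y y' hy hy'

/-! ### The centre-projection bound with link rows -/

/-- **THE WINDOWED CENTRE-TUBE BOUND WITH LINK ROWS**: `N ≥ 2`; a twist defect `W(ζ_k U) = c₀(U) + ∑_t g_t(curl k, U)` with
plaquette supports inside a vertical window `m ≥ 1`, link sets `E t` of transverse extent `≤ s` (`s ≥ 1`) through which `g_t ∘ curl`
reads `k`, per-link variation bounds `δ t ≥ 0`, defect link rows `½ linkRow ≤ b`; `c = 2(d−1)N|β| + b ≤ 1`, `i ≠ j`, `2R, 2T ≤ L` ⇒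
`|⟨(1/N) Re tr U_{R×T}⟩_{β,W,L}| ≤ (4 c^{⌈T/s⌉})^{#{r<R : m∣r}}`. [cite: Frohlich1979ZN, Eq. (7)–(9)] -/
theorem abs_wilsonLoop_le_of_linkDefect (hN : 2 ≤ N) {β : ℝ} (W : Perturbation d L N)
    {c₀ : GaugeConfig d L (SUN N) → ℝ} {supp : ι → Finset (Plaquette d L)}
    {gD : ι → (Plaquette d L → ZMod N) → GaugeConfig d L (SUN N) → ℝ} {E : ι → Finset (Edge d L)} {δ : ι → Edge d L → ℝ}
    (hW : ∀ (k : Edge d L → ZMod N) (U : GaugeConfig d L (SUN N)), W.total (twistOf k * U) = c₀ U + ∑ t, gD t (flux k) U)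
    (hdep : ∀ t U, DependsOn (fun φ => gD t φ U) (↑(supp t) : Set (Plaquette d L)))
    (hE : ∀ t (k k' : Edge d L → ZMod N) (U : GaugeConfig d L (SUN N)), (∀ e ∈ E t, k e = k' e) →
      gD t (flux k) U = gD t (flux k') U)
    (hδ0 : ∀ t e, 0 ≤ δ t e)
    (hδ : ∀ t (e : Edge d L) (k k' : Edge d L → ZMod N) (U : GaugeConfig d L (SUN N)), (∀ e', e' ≠ e → k e' = k' e') →
      |gD t (flux k) U - gD t (flux k') U| ≤ δ t e)
    {m : ℕ} (hm : 0 < m)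
    (hwin : ∀ t (i : Fin d), ∀ y ∈ iLinks i (supp t), ∀ y' ∈ iLinks i (supp t), (y i - y' i).valMinAbs.natAbs < m)
    {s : ℕ} (hs : 0 < s) (hext : ∀ t (i j : Fin d) (y y' : Site d L), (y, i) ∈ E t → (y', i) ∈ E t → jDist j y' y ≤ s)
    {b : ℝ} (hrowD : ∀ (i : Fin d) (y : Site d L), linkRow E δ i y / 2 ≤ b)
    {c : ℝ} (hc : 2 * ((d - 1 : ℕ) : ℝ) * |β| * N + b ≤ c) (hc1 : c ≤ 1) (x : Site d L) {i j : Fin d} (hij : i ≠ j)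
    {R T : ℕ} (hR : 2 * R ≤ L) (hT : 2 * T ≤ L) :
    |W.expectation (fundamentalRep (Fin N)) β (wilsonLoop (fundamentalRep (Fin N)) x i j R T)| ≤
      (4 * c ^ ((T + s - 1) / s)) ^ (selIdx m R).card :=
  abs_expectation_wilsonLoop_le_of_fluxDefect W hW β x i j R T fun U =>
    norm_znLoopW_le_link hN β hdep hE hδ0 hδ hm hwin hs hext hrowD hc hc1 U x hij hR hT

end Summit.Ventures.YMGap.RobustBall

end
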